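import Literature.MathematicalPhysics.QuantumFieldTheory.Balaban1983to89.B16Improved189FullBudget
import Literature.MathematicalPhysics.QuantumFieldTheory.Balaban1983to89.T4PersistentHistoryCount

/-!
# N20 (NE7b), ITEM (c) AGAINST PRINT'S INDUCTION: the cell's BANKED per-event credit run through the strengthened inductive statement (1.80)⁺ of [LF-II] pp. 384–387
# (`B16Improved189FullBudget`) — a terminal term `t = t₀ + p·m` (`m` = the number of EVENTS, renewals and mergers, in the component's genealogy) is ADMISSIBLE in every case of
# the printed induction with the located constants shifted by `p`, and at the horizon it turns the p. 384 factor `exp(−κ_k(X) − 2p₀(g_{j(X)}))` into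
# `exp(−2p₀(g_{j(X)})) · e^{−t₀} · (e^{−p})^{m}` — the per-record price «`c r ≤ ρ^{m r}`» that the stock budget of `…N20FinalLevelBankedBudget` consumes

Cell `pub-ymgap`, YM-PLAN Track A (HUMAN RULING D-0062); seat `pub-ymgap-dag-n20-d` (R134 (a) N20 NE7b s3 «W_K < 1, Σ W_K < ∞ from [B16] (1.79)–(1.89) pp. 383–387 directly»), gen 40 —
director-ym №374 line (E): «(c) the banking budget algebra typed ABSTRACTLY against `B16Lem384Induction` ∕ `B16Improved189FullBudget*` ∕ `T4PersistentHistoryCount` ∕ …».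
`--kind proof --supports stmt-QuantumFields-27366 --as helper` (K3⁸); COUNT-NEUTRAL; THEOREMS ONLY (0 `def`).  [LF-II] = [Balaban1989LargeFieldII].  Companions BY NAME:
`Step.Budget.{Consts.cost, Controls, ScaleData, merge}` and `B16Improved189FullBudget.{controlsT_iff, controlsT_zero_iff, case1T_183, resetT_p386, mergeT_controls, invariantT_all,
terminal_le_kappa_of_controlsT}` ((1.80)⁺ = (1.80) for the lowered budget `κ − t`), `T4WeightBudget.card_Icc_le_of_windows`, `T4HistoryPeeling.pow_eventCount_le_twoRate`.

WHY.  Print's induction (pp. 384–387) carries for every component `Z` of `Z_j` a budget `κ_j(Z)` with the factor form `exp(−κ_j(Z) − 2p₀(g_{j(Z)}))` (p. 384) and proves (1.80); it SPENDS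
two credits that the cell's NE7b proposes to BANK (R1, NOT PRINTED): at a MERGER the surplus «2p₀(g_{j(X)}) + 2p₀(g_{j(Y)}) − 2p₀(g_{j(Z)}) ≥ 2(1+β₀)⁻¹p₀(g_{j+1})» beyond the costs
`E + D` of (1.87)–(1.88) («for p₀ large and γ small enough»), and at a RENEWAL (p. 386: a new large field inside `Z`, «we have the new factor exp(−p₀(g_j)) … κ_{j+1}(Z) = p₀(g_j) −
O(1)…») the old budget `κ_j(Z₀) ≥ 0` («we do not have a better bound for it») — whose factor `exp(−κ_j(Z₀)) ≤ 1` is nevertheless still present in the product.  `B16Improved189FullBudget`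
re-ran the printed induction with an abstract TERMINAL TERM `t_j(Z) ≥ 0` on the right of (1.80) ((1.80)⁺ = `Controls b j K (κ − t) s`), the three located conditions absorbing it (birth:
`t ≤ Q(d′+1)`, `3Q ≤ a`; reset: `hsmall + t`; merger: terminal sub-additivity with overshoot `E_t`, `E + E_t + D ≤ q`).  THIS FILE instantiates the terminal term with a BANKED part:
`t = t₀ + p·m`, `t₀` any admissible term (print's candidate `κ₁d`, the size), `p ≥ 0` the credit banked PER EVENT and `m` the event count of the genealogy — a merger is ONE new event
(`m(T) ≤ m({x}) + m(T∖{x}) + 1`), a renewal is ONE new event and KEEPS the old leftover (`κ_{j+1}(Z) = κ_j(Z₀) + p₀(g_j) − cost`, the banked reset), a continuation adds none.  Then every case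
lemma of the companion applies BY NAME with the constants shifted by `p` (§1), the outer induction `invariantT_all` is untouched, and at the horizon `K = 0` (1.80)⁺ reads `t₀ + p·m ≤
κ_k(X)` (§2): the factor is `≤ exp(−P)·e^{−t₀}·(e^{−p})^{m}` — with `P` the `2p₀(g_{j(X)})`-term and `m ≥ (k + 1 − j(X))∕N − 1` from the event windows (`card_Icc_le_of_windows`), the
two-rate shape `(e^{−p})⁻¹·((e^{−p})^{1∕N})^{k+1−j(X)}` (§3) = the per-record price of `…N20FinalLevelBankedBudget.recordPrice_le_twoRate_of_uniformWindow` and the `σ^{age}` of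
`T4PersistentHistoryCount.slotPrice_le`.  WHAT BANKING COSTS, exactly (§1 docstrings, §4): per merger `p ≤ q − E − E_t − D` (the slack of (1.88); at print's `β₀ = 1∕7`, `q = (7∕4)·p₀(g_{j+1})`),
per renewal `Σ_{window} cost + t₀′ + p ≤ p₀(g_j)` (the slack of p. 386's «because Z is a small domain»).

WHAT IS PROVED (kernel arithmetic over the bookkeeping model; zero `sorry`; the companions BY NAME).
§1 ADMISSIBILITY, CASE BY CASE: `bankedT_nonneg`, ★ `bankedT_sub` (terminal sub-additivity of `t₀ + p·m` with overshoot `E_t + p` from `t₀`'s with `E_t` and one new event), ★★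
   `mergeT_controls_banked` ((1.85)–(1.88) with the banked term: `mergeT_controls` at `E_t + p`, `hbudget : E + E_t + p + D ≤ q`), `terminal_le_budget_of_controlsT` (at ANY horizon the
   term is below the budget when costs are `≥ 0`), ★★ `resetT_banked` (p. 386's reset KEEPING the old leftover and banking `p` for the new event: (1.80)⁺ at `j+1` for the budget
   `κ_j(Z₀) + p − cost_{j+1}` and the term `t_old + t₀′ + p` from `hsmall : Σ_{window} cost + t₀′ + p ≤ p_new`), `case1T_banked` ((1.83): term carried, `case1T_183` verbatim).
§2 AT THE HORIZON: ★★ `bankedFactor_le` (`K = 0`, (1.80)⁺ with `t₀ + p·m`, factor form `F ≤ exp(−κ − P)` ⇒ `F ≤ exp(−P)·exp(−t₀)·exp(−p)^m`), ★★★ `bankedFactor_le_of_history`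
   ((1.80)⁺ at a first scale + a step at every scale ⇒ the same for every horizon-0 component whose term dominates `t₀ + p·m` — `invariantT_all` ∘ §2).
§3 THE EVENT COUNT AND THE TWO-RATE SHAPE: `span_le_of_eventWindows` (`card_Icc_le_of_windows` with `#S = m + 1`: birth counted), ★★ `bankedFactor_le_twoRate` (§2 + windows ⇒
   `F ≤ exp(−P)·exp(−t₀)·(e^{−p})⁻¹·((e^{−p})^{1∕N})^{k+1−j}`, `pow_eventCount_le_twoRate`).
§4 THE SHIFTED LOCATED CONDITIONS: `banking_slack_iff` (`E + (E_t + p) + D ≤ q ↔ p ≤ q − E − E_t − D`), `merger_surplus_at_one_seventh` (`β₀ = 1∕7`: `2(1+β₀)⁻¹ = 7∕4`),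
   ★ `toy_history_banked` (NON-VACUITY: explicit constants, a birth, one continuation, one banked merger-free renewal-free horizon with `m = 1` banked at a reset, the §2 bound firing with
   `p > 0`).

v1.1 (APPEND-ONLY §5; every v1 declaration byte-identical; the import `T4HistoryPeeling` widened to its importer `T4PersistentHistoryCount` for `p0Profile_ir_le`): THE BANKED CREDIT AT
THE INFRARED COUPLING, K-UNIFORMLY — along a run obeying the typed (2.7) [III] (`B14.FlowIneq27`, first member) `p₀(g_K) ≤ (1+β₀)·p₀(g_s)` for `s ≤ K`, so ONE banking clause on the
infrared coupling `g_K` implies the shifted merger condition at EVERY scale (`merger_banking_of_ir`: `E + E_t + D + p ≤ 2(1+β₀)⁻²·p₀(g_K)` ⇒ `E + (E_t + p) + D ≤ 2(1+β₀)⁻¹p₀(g_{j+1})`)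
and the shifted reset condition at every scale (`reset_banking_of_ir`: window costs `≤ (1 − a)·p₀(g_j)` and `p ≤ a(1+β₀)⁻¹·p₀(g_K)` ⇒ `Σ cost + t₀′ + p ≤ p₀(g_j)`); with `p = c·p₀(g_K)`
the rate condition is `…N20FinalLevelBankedBudget.survivalRate_banked_pos_iff`.

HONEST FRAMING.  [bookkeeping] in the model of `Step.Budget` ∕ `B16Lem384Induction` ∕ `B16Improved189FullBudget`: components, budgets, profiles, horizons, terminal terms and now event
counts are abstract data; the binders (`hsub`, `htsub₀`, `hm`, `hsmall`, `hcost`, the factor form `hF`) are displayed hypotheses exactly as print's located conditions are there.  The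
BANKING itself — keeping `κ_j(Z₀)` at a reset and charging `p` per event to the slacks — is the cell's R1 and is NOT PRINTED ([LF-II] spends both credits); this file shows only that the
printed induction TOLERATES it at the stated price in constants, and what it yields at the horizon.  The identification of the model's events ∕ windows with def-T's histories of record
(READING (ID) of `T4PersistentHistoryCount`) and of the factor `F` with [IV] (0.3)'s fibre ratio (junction NC-NE7b-α) are NOT here.  NO inequality of Bałaban's is asserted; NE7 ∕ NE7b ∕
NE7c NOT PRINTED for `d = 4` ∕ NOT proved; N20 NOT discharged; counts UNMOVED (typed 28∕28 · discharged 8∕27); one finite four-torus programme at fixed `ε` — NOT ℝ⁴, NOT OS, NOT a mass gap,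
NOT the Clay problem.  No `def`, no `instance`, no `notation`, no `sorry`; no decl below carries a cite tag.
-/

open Finset

namespace YMDAG.UVSplit

open Literature.MathematicalPhysics.QuantumFieldTheory.Balaban1983to89
open Literature.MathematicalPhysics.QuantumFieldTheory.Balaban1983to89.Step
open Literature.MathematicalPhysics.QuantumFieldTheory.Balaban1983to89.Step.Budget
open Literature.MathematicalPhysics.QuantumFieldTheory.Balaban1983to89.B16Improved189FullBudget
open T4WeightBudget (card_Icc_le_of_windows)
open T4HistoryPeeling (pow_eventCount_le_twoRate)

/-! ## §1 The banked terminal term is admissible in every case of the printed induction -/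

section Cases

/-- The banked term `t₀ + p·m` is non-negative when its parts are. [folklore] -/
theorem bankedT_nonneg {t₀ p : ℝ} {m : ℕ} (ht₀ : 0 ≤ t₀) (hp : 0 ≤ p) : 0 ≤ t₀ + p * m :=
  add_nonneg ht₀ (mul_nonneg hp (Nat.cast_nonneg m))

/-- ★ **TERMINAL SUB-ADDITIVITY OF THE BANKED TERM AT A SPLIT.**  If the size part is sub-additive with overshoot `E_t` (`B16Improved189FullBudget`'s `htsub`) and the merger is ONE new
event — `m(T) ≤ m({x}) + m(T∖{x}) + 1` — then `t₀ + p·m` is sub-additive with overshoot `E_t + p` (`p ≥ 0`). [bookkeeping] -/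
theorem bankedT_sub {tT tx tY Et p : ℝ} {mT mx mY : ℕ} (hp : 0 ≤ p) (htsub : tT ≤ tx + tY + Et) (hm : mT ≤ mx + mY + 1) :
    tT + p * mT ≤ (tx + p * mx) + (tY + p * mY) + (Et + p) := by
  have hm' : (mT : ℝ) ≤ mx + mY + 1 := by exact_mod_cast hm
  nlinarith [mul_le_mul_of_nonneg_left hm' hp]

/-- ★★ **THE MERGER (1.85)–(1.88) WITH THE BANKED TERM** (`mergeT_controls` BY NAME at the overshoot `E_t + p`): pieces `ι` with contributions, family functions `cost`, `P`, `rhs`, a size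
term `t₀` and an EVENT COUNT `m` on sub-families (one new event per split: `hm`), connectedness with the endpoint property, the single-piece base for `rhs + (t₀ + p·m)`, print's split
binders `hP ∕ hc ∕ hsub`, the size sub-additivity `htsub₀` with overshoot `E_t`, and the located condition SHIFTED BY THE BANKED CREDIT, `E + (E_t + p) + D ≤ q` ⇒ (1.80)⁺ at scale `j+1`
for the merged component with the terminal term `t₀(S) + p·m(S)` (any budget `≥` (1.85), any term `≤` it).  Banking `p` per merger is admissible exactly when `p` fits in the slack of
(1.88). [bookkeeping] -/
theorem mergeT_controls_banked (b : Budget.Consts) (j : ℕ) {ι : Type*} [DecidableEq ι] (contrib : ι → ℝ)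
    (cost P rhs t₀ : Finset ι → ℝ) (m : Finset ι → ℕ) (S : Finset ι) (hne : S.Nonempty) (Conn : Finset ι → Prop) (hconn : Conn S)
    (q E Et D p : ℝ) (hp : 0 ≤ p)
    (hleaf : ∀ T, T ⊆ S → Conn T → 2 ≤ T.card → ∃ x ∈ T, Conn (T.erase x))
    (hsingle : ∀ x ∈ S, rhs {x} + (t₀ {x} + p * m {x}) ≤ merge contrib {x} (cost {x}) (P {x}))
    (hP : ∀ T x, T ⊆ S → x ∈ T → 2 ≤ T.card → q ≤ P {x} + P (T.erase x) - P T)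
    (hc : ∀ T x, T ⊆ S → x ∈ T → 2 ≤ T.card → Conn T → Conn (T.erase x) → cost T ≤ cost {x} + cost (T.erase x) + D)
    (hsub : ∀ T x, T ⊆ S → x ∈ T → 2 ≤ T.card → Conn T → Conn (T.erase x) → rhs T ≤ rhs {x} + rhs (T.erase x) + E)
    (htsub₀ : ∀ T x, T ⊆ S → x ∈ T → 2 ≤ T.card → Conn T → Conn (T.erase x) → t₀ T ≤ t₀ {x} + t₀ (T.erase x) + Et)
    (hm : ∀ T x, T ⊆ S → x ∈ T → 2 ≤ T.card → Conn T → Conn (T.erase x) → m T ≤ m {x} + m (T.erase x) + 1)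
    (hbudget : E + (Et + p) + D ≤ q)
    (K : ℕ) (size : ℕ → ℝ) (κZ tZ : ℝ)
    (hrhsZ : ∑ n ∈ Finset.Ioc (j + 1) (j + 1 + K), b.cost n (size n) ≤ rhs S) (htZ : tZ ≤ t₀ S + p * m S)
    (hκZ : merge contrib S (cost S) (P S) ≤ κZ) :
    Controls b (j + 1) K (κZ - tZ) size :=
  mergeT_controls b j contrib cost P rhs (fun T => t₀ T + p * m T) S hne Conn hconn q E (Et + p) D hleaf hsingle hP hc hsub
    (fun T x hT hx h2 hC hC' => bankedT_sub hp (htsub₀ T x hT hx h2 hC hC') (hm T x hT hx h2 hC hC')) hbudget K size κZ tZ hrhsZ htZ hκZ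

/-- **AT ANY HORIZON THE TERM IS BELOW THE BUDGET** when the carried costs are non-negative: (1.80)⁺ `Σ cost + t ≤ κ` ⇒ `t ≤ κ` (at `K = 0` this is `controlsT_zero_iff`). [bookkeeping] -/
theorem terminal_le_budget_of_controlsT (b : Budget.Consts) (j K : ℕ) {κ t : ℝ} (s : ℕ → ℝ)
    (hcost : ∀ n ∈ Finset.Ioc j (j + K), 0 ≤ b.cost n (s n)) (h : Controls b j K (κ - t) s) : t ≤ κ := by
  rw [controlsT_iff] at h
  linarith [Finset.sum_nonneg hcost]

/-- ★★ **THE BANKED RESET** (p. 386 — a new large field inside the component: ONE new event).  Print resets `κ_{j+1}(Z) = p₀(g_j) − cost` and DROPS the old `κ_j(Z₀) ≥ 0`; the banked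
bookkeeping KEEPS it (its factor `exp(−κ_j(Z₀)) ≤ 1` is still in the product) and banks `p` for the new event: from (1.80)⁺ at scale `j` for `Z₀` (budget `κ₀`, term `t_old`, costs
`≥ 0`, any horizon) and the smallness of p. 386 charged with the new size term AND the banked credit, `Σ_{n=j+1}^{j+1+K′} cost + t₀′ + p ≤ p_new` («because Z is a small domain … K =
R_{j+1}»), (1.80)⁺ at scale `j+1` for the budget `κ₀ + p_new − cost_{j+1}` and the term `t_old + t₀′ + p` (`resetT_p386` BY NAME for the budget `κ₀ + p_new`).  The cell's R1 at a
renewal; NOT PRINTED. [bookkeeping] -/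
theorem resetT_banked (b : Budget.Consts) (j K K' : ℕ) {κ₀ t_old pnew t₀' p : ℝ} (s₀ s : ℕ → ℝ)
    (hcost : ∀ n ∈ Finset.Ioc j (j + K), 0 ≤ b.cost n (s₀ n)) (hold : Controls b j K (κ₀ - t_old) s₀)
    (hsmall : ∑ n ∈ Finset.Ioc j (j + 1 + K'), b.cost n (s n) + t₀' + p ≤ pnew) :
    Controls b (j + 1) K' (κ₀ + pnew - b.cost (j + 1) (s (j + 1)) - (t_old + t₀' + p)) s := by
  have h1 := terminal_le_budget_of_controlsT b j K s₀ hcost hold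
  exact resetT_p386 b j K' (κ₀ + pnew) (t_old + t₀' + p) s (by linarith)

/-- **THE CONTINUATION (1.83) CARRIES THE BANKED TERM** (no event: `m` unchanged; `case1T_183` BY NAME). [bookkeeping] -/
theorem case1T_banked (b : Budget.Consts) (j K : ℕ) (hK : 1 ≤ K) {κ t₀ p : ℝ} {m : ℕ} (s : ℕ → ℝ)
    (h : Controls b j K (κ - (t₀ + p * m)) s) : Controls b (j + 1) (K - 1) (κ - b.cost (j + 1) (s (j + 1)) - (t₀ + p * m)) s :=
  case1T_183 b j K hK κ (t₀ + p * m) s h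

end Cases

/-! ## §2 At the horizon: the banked events come out of the factor -/

section Horizon

/-- ★★ **THE BANKED FACTOR AT THE HORIZON.**  `K = 0` under (1.80)⁺ with the banked term: `t₀ + p·m ≤ κ` (`controlsT_zero_iff`); with the factor form of p. 384, `F ≤ exp(−κ − P)` (`P` =
the `2p₀(g_{j(X)})`-term), the factor is `≤ exp(−P) · exp(−t₀) · exp(−p)^m` — the birth factor, the size factor and ONE banked credit `ρ = e^{−p}` PER EVENT. [bookkeeping] -/
theorem bankedFactor_le (b : Budget.Consts) (k : ℕ) {κ t₀ p P F : ℝ} {m : ℕ} (s : ℕ → ℝ)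
    (hC : Controls b k 0 (κ - (t₀ + p * m)) s) (hF : F ≤ Real.exp (-κ - P)) :
    F ≤ Real.exp (-P) * Real.exp (-t₀) * Real.exp (-p) ^ m := by
  have ht : t₀ + p * m ≤ κ := (controlsT_zero_iff b k κ (t₀ + p * m) s).mp hC
  rw [← Real.exp_nat_mul, ← Real.exp_add, ← Real.exp_add]
  exact hF.trans (Real.exp_le_exp.2 (by nlinarith))

/-- ★★★ **… FROM A BANKED HISTORY** (`invariantT_all` ∘ `bankedFactor_le`): (1.80)⁺ with terminal terms `t j` at a first scale `j₀` and a step at every scale (assembled by the consumer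
from `bornT_controls` ∕ `case1T_banked` ∕ `resetT_banked` ∕ `mergeT_controls_banked`, every budget a lower bound by its case value), a horizon-`0` component `X` of `Z_k` whose term
dominates a banked term, `t₀ + p·m ≤ t k X`, and the factor form `F ≤ exp(−κ_k(X) − P)` ⇒ `F ≤ exp(−P)·exp(−t₀)·exp(−p)^m`. [bookkeeping] -/
theorem bankedFactor_le_of_history (b : Budget.Consts) (D : (j : ℕ) → ScaleData j) (t : (j : ℕ) → (D j).Comp → ℝ) (j₀ : ℕ)
    (hbase : ∀ Z, Controls b j₀ ((D j₀).K Z) ((D j₀).κ Z - t j₀ Z) ((D j₀).size Z))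
    (hstep : ∀ j, j₀ ≤ j → (∀ Z, Controls b j ((D j).K Z) ((D j).κ Z - t j Z) ((D j).size Z)) →
      ∀ Z, Controls b (j + 1) ((D (j + 1)).K Z) ((D (j + 1)).κ Z - t (j + 1) Z) ((D (j + 1)).size Z))
    {k : ℕ} (hk : j₀ ≤ k) (X : (D k).Comp) (hK : (D k).K X = 0) {t₀ p P F : ℝ} {m : ℕ} (ht : t₀ + p * m ≤ t k X)
    (hF : F ≤ Real.exp (-(D k).κ X - P)) : F ≤ Real.exp (-P) * Real.exp (-t₀) * Real.exp (-p) ^ m := by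
  have hall := invariantT_all b D t j₀ hbase hstep k hk X
  rw [hK] at hall
  have hle : t k X ≤ (D k).κ X := (controlsT_zero_iff b k ((D k).κ X) (t k X) ((D k).size X)).mp hall
  have hC : Controls b k 0 ((D k).κ X - (t₀ + p * m)) ((D k).size X) :=
    (controlsT_zero_iff b k ((D k).κ X) (t₀ + p * m) ((D k).size X)).mpr (ht.trans hle)
  exact bankedFactor_le b k ((D k).size X) hC hF

end Horizon

/-! ## §3 The event count from the windows, and the two-rate shape of the banked factor -/

section Windows

/-- **THE SPAN OF A PENDING LIFE AGAINST ITS EVENTS** (`T4WeightBudget.card_Icc_le_of_windows` with the birth counted among the `m + 1` event steps): if every step of `[j, k]` lies less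
than `N` steps after an event step, then `k + 1 − j ≤ N·(m + 1)` — the `hwin` of `…N20FinalLevelBankedBudget.recordPrice_le_twoRate_of_uniformWindow`. [folklore] -/
theorem span_le_of_eventWindows {j k N m : ℕ} (S : Finset ℕ) (hS : S.card = m + 1)
    (hcov : ∀ x ∈ Finset.Icc j k, ∃ e ∈ S, e ≤ x ∧ x < e + N) : k + 1 - j ≤ N * (m + 1) := by
  rw [← hS]
  exact card_Icc_le_of_windows S hcov

/-- ★★ **THE BANKED FACTOR IN THE TWO-RATE SHAPE**: §2's `exp(−P)·exp(−t₀)·ρ^m`, `ρ = e^{−p}`, with the window count `k + 1 − j ≤ N·(m + 1)` ⇒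
`F ≤ exp(−P)·exp(−t₀)·(ρ⁻¹·(ρ^{1∕N})^{k + 1 − j})` — the survival rate `σ = ρ^{1∕N} = e^{−p∕N}` per step of age (`T4HistoryPeeling.pow_eventCount_le_twoRate`). [bookkeeping] -/
theorem bankedFactor_le_twoRate (b : Budget.Consts) (k : ℕ) {κ t₀ p P F : ℝ} {m : ℕ} (s : ℕ → ℝ) (hp : 0 ≤ p)
    (hC : Controls b k 0 (κ - (t₀ + p * m)) s) (hF : F ≤ Real.exp (-κ - P)) {N j : ℕ} (hN : 0 < N) (hwin : k + 1 - j ≤ N * (m + 1)) :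
    F ≤ Real.exp (-P) * Real.exp (-t₀) * ((Real.exp (-p))⁻¹ * (Real.exp (-p) ^ ((1 : ℝ) / N)) ^ (k + 1 - j)) := by
  have h1 := bankedFactor_le b k s hC hF
  have hρ1 : Real.exp (-p) ≤ 1 := Real.exp_le_one_iff.2 (by linarith)
  have h2 : Real.exp (-p) ^ m ≤ (Real.exp (-p))⁻¹ * (Real.exp (-p) ^ ((1 : ℝ) / N)) ^ (k + 1 - j) :=
    pow_eventCount_le_twoRate (Real.exp_pos _) hρ1 hN hwin
  exact h1.trans (mul_le_mul_of_nonneg_left h2 (mul_nonneg (Real.exp_pos _).le (Real.exp_pos _).le))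

end Windows

/-! ## §4 The shifted located conditions, and non-vacuity -/

section Located

/-- **WHAT BANKING COSTS AT A MERGER**: the shifted condition `E + (E_t + p) + D ≤ q` says `p ≤ q − E − E_t − D` — bank at most the slack of (1.88). [folklore] -/
theorem banking_slack_iff {E Et D q p : ℝ} : E + (Et + p) + D ≤ q ↔ p ≤ q - E - Et - D := by
  constructor <;> intro h <;> linarith

/-- At print's `β₀ = 1∕7` (p. 389 «for example, take β₀ = 1/7») the merger surplus coefficient is `2(1+β₀)⁻¹ = 7∕4`: `q = (7∕4)·p₀(g_{j+1})`. [folklore] -/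
theorem merger_surplus_at_one_seventh : (2 : ℝ) * (1 + 1 / 7)⁻¹ = 7 / 4 := by norm_num

/-- ★ **NON-VACUITY OF THE BANKED HISTORY.**  Bookkeeping constants `O(1) = M = 1`, `d = 1`, `R ≡ 1` (`cost n s = s`); a component with budget `κ₀ = 5`, size term `t_old = 2`, profile
`≡ 1`, horizon `1` at scale `1` ((1.80)⁺: `1 + 2 ≤ 5`); a BANKED RESET at scale `1 → 2` with fresh credit `p_new = 4`, new size term `t₀′ = 1`, banked `p = 1`, horizon `K′ = 1`
(`hsmall : (1 + 1) + 1 + 1 ≤ 4`): budget `5 + 4 − 1 = 8`, term `2 + 1 + 1 = 4`; one continuation (1.83) to the horizon at scale `3` (budget `7`, term `4`); there any factor bound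
`F ≤ exp(−7 − P)` gives `F ≤ exp(−P)·exp(−3)·exp(−1)^1` — one banked event visible in the exponent. [bookkeeping] -/
theorem toy_history_banked {P F : ℝ} (hF : F ≤ Real.exp (-7 - P)) :
    let b : Budget.Consts := ⟨1, 1, 1, fun _ => 1⟩
    Controls b 1 1 (5 - 2) (fun _ => 1) ∧ Controls b 2 1 (5 + 4 - b.cost 2 1 - (2 + 1 + 1)) (fun _ => 1) ∧
      Controls b 3 0 (7 - (3 + 1 * (1 : ℕ))) (fun _ => 1) ∧ F ≤ Real.exp (-P) * Real.exp (-3) * Real.exp (-1) ^ (1 : ℕ) := by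
  intro b
  have hcost : ∀ n (s : ℝ), b.cost n s = s := by
    intro n s
    simp [b, Budget.Consts.cost]
  have h1 : Controls b 1 1 (5 - 2) (fun _ => 1) := by
    rw [controlsT_iff, show (1 : ℕ) + 1 = 2 by rfl, show Finset.Ioc 1 2 = {2} by rfl, Finset.sum_singleton, hcost]
    norm_num
  have h2 : Controls b 2 1 (5 + 4 - b.cost 2 1 - (2 + 1 + 1)) (fun _ => 1) := by
    refine resetT_banked b 1 1 1 (fun _ => 1) (fun _ => 1) (fun n _ => by rw [hcost]; norm_num) h1 ?_
    rw [show (1 : ℕ) + 1 + 1 = 3 by rfl, show Finset.Ioc 1 3 = {2, 3} by rfl, Finset.sum_pair (by norm_num), hcost, hcost]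
    norm_num
  have h3 : Controls b 3 0 (7 - (3 + 1 * (1 : ℕ))) (fun _ => 1) := by
    have h := case1T_183 b 2 1 le_rfl (5 + 4 - b.cost 2 1) (2 + 1 + 1) (fun _ => 1) h2
    rw [hcost, hcost] at h
    norm_num at h ⊢
    exact h
  refine ⟨h1, h2, h3, ?_⟩
  exact bankedFactor_le b 3 (fun _ => 1) h3 hF

end Located

/-! ## §5 (v1.1) The banked credit at the INFRARED coupling, K-uniformly along the flow -/

section Infrared

open T4PersistentHistoryCount (p0Profile_ir_le)

/-- Along the typed (2.7) [III] (`B14.FlowIneq27`, first member; `β₀, A₀ ≥ 0`, `log g_K⁻² ≥ 0`) the infrared profile is the smallest up to `(1+β₀)`: `(1+β₀)⁻²·p₀(g_K) ≤ (1+β₀)⁻¹·p₀(g_s)`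
for `s ≤ K` (`T4PersistentHistoryCount.p0Profile_ir_le`). [folklore] -/
theorem p0Profile_ir_inv_le {g : ℕ → ℝ} {β' β₀ A₀ : ℝ} {p₀ K s : ℕ} (h27 : B14.FlowIneq27 g β' β₀ p₀ K) (hβ : 0 ≤ β₀) (hA : 0 ≤ A₀)
    (hxK : 0 ≤ Real.log ((g K) ^ 2)⁻¹) (hs : s ≤ K) :
    (1 + β₀)⁻¹ * (1 + β₀)⁻¹ * p0Profile A₀ p₀ (g K) ≤ (1 + β₀)⁻¹ * p0Profile A₀ p₀ (g s) := by
  have hir := p0Profile_ir_le h27 hβ hA hxK hs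
  have hb : 0 < 1 + β₀ := by linarith
  have hinv : 0 ≤ (1 + β₀)⁻¹ := inv_nonneg.2 hb.le
  calc (1 + β₀)⁻¹ * (1 + β₀)⁻¹ * p0Profile A₀ p₀ (g K) ≤ (1 + β₀)⁻¹ * (1 + β₀)⁻¹ * ((1 + β₀) * p0Profile A₀ p₀ (g s)) :=
        mul_le_mul_of_nonneg_left hir (mul_nonneg hinv hinv)
    _ = (1 + β₀)⁻¹ * p0Profile A₀ p₀ (g s) := by field_simp

/-- ★★ **BANKING AT A MERGER, K-UNIFORMLY**: ONE clause on the infrared coupling, `E + E_t + D + p ≤ 2(1+β₀)⁻²·p₀(g_K)`, implies the shifted located condition of `mergeT_controls_banked` at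
EVERY merger scale `j + 1 ≤ K`: `E + (E_t + p) + D ≤ 2(1+β₀)⁻¹·p₀(g_{j+1})` = the surplus «2(1+β₀)⁻¹p₀(g_{j+1})» of (1.87). [bookkeeping] -/
theorem merger_banking_of_ir {g : ℕ → ℝ} {β' β₀ A₀ : ℝ} {p₀ K j : ℕ} (h27 : B14.FlowIneq27 g β' β₀ p₀ K) (hβ : 0 ≤ β₀) (hA : 0 ≤ A₀)
    (hxK : 0 ≤ Real.log ((g K) ^ 2)⁻¹) (hj : j + 1 ≤ K) {E Et D p : ℝ}
    (h : E + Et + D + p ≤ 2 * ((1 + β₀)⁻¹ * (1 + β₀)⁻¹ * p0Profile A₀ p₀ (g K))) :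
    E + (Et + p) + D ≤ 2 * (1 + β₀)⁻¹ * p0Profile A₀ p₀ (g (j + 1)) := by
  have key := p0Profile_ir_inv_le h27 hβ hA hxK hj
  linarith

/-- ★★ **BANKING AT A RENEWAL, K-UNIFORMLY**: if the window costs and the new size term take at most the fraction `1 − a` of the fresh credit, `Σ cost + t₀′ ≤ (1 − a)·p₀(g_j)`, and the banked
credit is at most `a(1+β₀)⁻¹·p₀(g_K)` (`a ≥ 0`), then the shifted smallness of `resetT_banked` holds at EVERY renewal scale `j ≤ K`: `Σ cost + t₀′ + p ≤ p₀(g_j)`. [bookkeeping] -/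
theorem reset_banking_of_ir {g : ℕ → ℝ} {β' β₀ A₀ : ℝ} {p₀ K j : ℕ} (h27 : B14.FlowIneq27 g β' β₀ p₀ K) (hβ : 0 ≤ β₀) (hA : 0 ≤ A₀)
    (hxK : 0 ≤ Real.log ((g K) ^ 2)⁻¹) (hj : j ≤ K) {W t₀' p a : ℝ} (ha : 0 ≤ a)
    (hw : W + t₀' ≤ (1 - a) * p0Profile A₀ p₀ (g j)) (hp : p ≤ a * ((1 + β₀)⁻¹ * p0Profile A₀ p₀ (g K))) :
    W + t₀' + p ≤ p0Profile A₀ p₀ (g j) := by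
  have hir := p0Profile_ir_le h27 hβ hA hxK hj
  have hb : 0 < 1 + β₀ := by linarith
  have key : (1 + β₀)⁻¹ * p0Profile A₀ p₀ (g K) ≤ p0Profile A₀ p₀ (g j) := by
    calc (1 + β₀)⁻¹ * p0Profile A₀ p₀ (g K) ≤ (1 + β₀)⁻¹ * ((1 + β₀) * p0Profile A₀ p₀ (g j)) :=
          mul_le_mul_of_nonneg_left hir (inv_nonneg.2 hb.le)
      _ = p0Profile A₀ p₀ (g j) := by field_simp
  nlinarith [mul_le_mul_of_nonneg_left key ha]

end Infrared

end YMDAG.UVSplit
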